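import Mathlib
import Summits.NavierStokesRegularity.NavierStokesRegularity.Theorems.EulerZoomLiouvillePowerGaugeEulerLiouvilleSimilarityBernoulliMember
import HarnessLib.Audit

/-!
# Crux E `PowerGaugeEulerLiouville` (stmt-NavierStokesRegularity-19832): TRAPPING BY A MOVING SPHERE WITHOUT FAST INFLOW
# (kinematic companion of ns-cas-k2 g0's `…MovingSpherePiercing`; width seat ns-cas-k2 g2)

Route `EulerZoomLiouville` (NavierStokesRegularity), crux E.  Classical Euler on `(−∞,0)` with a continuous gradient majorant `Λ` (Cauchy–Lipschitz flow
`φ(σ; τ₀, x₀) = ODE.evolutionMap u τ₀ σ x₀`), similarity exponent `n`, moving sphere `‖x‖ = R(−σ)ⁿ`.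
* `confined_of_noFastInflow` — if on the moving sphere of radius `R` there is NO fast-inflow point at any time `σ ≤ τ₀`
  (`⟪x, u σ x⟫ > −n‖x‖²/(−σ)` whenever `‖x‖ = R(−σ)ⁿ`), then every backward trajectory starting inside the moving ball at time `τ₀` stays inside it for all
  `σ ≤ τ₀`: at a last crossing time the function `‖φ(σ)‖² − R²(−σ)^{2n}` would have a one-sided maximum, and Fermat's inequality there IS the fast-inflow
  inequality (the argument of g0's `curl_eq_zero_of_exit`, read kinematically);
* `confined_of_boundedSpeed` — in particular a bound `(−σ)^{1−n}‖u(σ,x)‖ ≤ b` on the sphere with `b < nR` traps every trajectory from inside.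
So for members with bounded scaled speed on large spheres (e.g. DSS members with bounded profile) EVERY backward trajectory is confined, and g0's binder `hconf`
is the statement that the member is irrotational (`SimilarityBernoulli.curl_eq_zero_of_confinedNull_of_boundedSpeed`).

WHAT THIS IS NOT: not NS regularity, not the crux E — kinematics of hypothetical blow-up members. [folklore]
-/

noncomputable section

set_option linter.dupNamespace false

open MeasureTheory Set Filter Topology Metric Function
open scoped NNReal ENNReal ContDiff InnerProductSpace RealInnerProductSpace

namespace Summit.NavierStokesRegularity.NavierStokesRegularity.Theorems.PowerGaugeEulerLiouville.MovingSpherePiercing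

open Literature.Analysis Literature.Analysis.FluidPDE Literature.Analysis.FunctionSpaces
open Summit.NavierStokesRegularity.NavierStokesRegularity.Theorems.PowerGaugeEulerLiouville.VorticityBirth

variable {u : ℝ → EuclideanSpace ℝ (Fin 3) → EuclideanSpace ℝ (Fin 3)} {p : ℝ → EuclideanSpace ℝ (Fin 3) → ℝ} {Λ : ℝ → ℝ}
  {n : ℝ}

/-- **TRAPPING BY A MOVING SPHERE WITHOUT FAST INFLOW.**  Classical Euler on `(−∞,0)` with a continuous gradient majorant; if for all `σ ≤ τ₀` the moving
sphere `‖x‖ = R(−σ)ⁿ` carries no fast-inflow point (`−n‖x‖²/(−σ) < ⟪x, u σ x⟫` there), then the backward trajectory of every `x₀` with `‖x₀‖ < R(−τ₀)ⁿ`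
satisfies `‖φ(σ; τ₀, x₀)‖ < R(−σ)ⁿ` for all `σ ≤ τ₀`. [folklore] -/
-- adapted from …MovingSpherePiercing (`curl_eq_zero_of_exit`, ns-cas-k2 g0): the same last-crossing / Fermat argument, read kinematically
theorem confined_of_noFastInflow (hcl : IsClassicalEulerSolutionOn (Iio 0) 0 u p) (hΛc : ContinuousOn Λ (Iio 0))
    (hΛ : ∀ s : ℝ, s < 0 → ∀ y, ‖fderiv ℝ (u s) y‖ ≤ Λ s) {R τ₀ : ℝ} (hR : 0 < R) (hτ₀ : τ₀ < 0)
    (hno : ∀ σ : ℝ, σ ≤ τ₀ → ∀ x : EuclideanSpace ℝ (Fin 3), ‖x‖ = R * (-σ) ^ n →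
      -(n * ‖x‖ ^ 2 / (-σ)) < ⟪x, u σ x⟫)
    {x₀ : EuclideanSpace ℝ (Fin 3)} (hx₀ : ‖x₀‖ < R * (-τ₀) ^ n) {σ : ℝ} (hσ : σ ≤ τ₀) :
    ‖ODE.evolutionMap u τ₀ σ x₀‖ < R * (-σ) ^ n := by
  by_contra hge
  push Not at hge
  have hlip : ODE.IsUniformlyLipschitzOn u (Iio 0) := isUniformlyLipschitzOn hcl hΛc hΛ
  set X : ℝ → EuclideanSpace ℝ (Fin 3) := fun σ => ODE.evolutionMap u τ₀ σ x₀ with hX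
  have hXc : ContinuousOn X (Iio 0) := hlip.continuousOn_evolutionMap (convex_Iio 0) hτ₀ x₀
  have hXd : ∀ σ : ℝ, σ < 0 → HasDerivAt X (u σ (X σ)) σ := fun σ hσ =>
    hlip.hasDerivAt_evolutionMap (convex_Iio 0) hτ₀ (Iio_mem_nhds hσ) x₀
  have hX0 : X τ₀ = x₀ := ODE.evolutionMap_self u τ₀ x₀
  set f : ℝ → ℝ := fun σ => ‖X σ‖ ^ 2 - R ^ 2 * (-σ) ^ (2 * n) with hf
  have hfc : ContinuousOn f (Iio 0) := by
    refine (hXc.norm.pow 2).sub (continuousOn_const.mul ((continuousOn_neg).rpow_const fun σ hσ => Or.inl ?_))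
    exact (neg_pos.2 (mem_Iio.1 hσ)).ne'
  have hsq : ∀ σ : ℝ, σ < 0 → (R * (-σ) ^ n) ^ 2 = R ^ 2 * (-σ) ^ (2 * n) := by
    intro σ hσ
    rw [mul_pow, ← Real.rpow_natCast ((-σ) ^ n) 2, ← Real.rpow_mul (by linarith)]
    push_cast; ring_nf
  have hfneg : f τ₀ < 0 := by
    have h1 : ‖X τ₀‖ ^ 2 < (R * (-τ₀) ^ n) ^ 2 := by
      rw [hX0]; exact pow_lt_pow_left₀ hx₀ (norm_nonneg _) two_ne_zero
    simp only [hf]; rw [← hsq τ₀ hτ₀]; linarith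
  have hσs0 : σ < 0 := lt_of_le_of_lt hσ hτ₀
  have hfσs : 0 ≤ f σ := by
    have hRn : 0 ≤ R * (-σ) ^ n := mul_nonneg hR.le (Real.rpow_nonneg (by linarith) _)
    have h1 : (R * (-σ) ^ n) ^ 2 ≤ ‖X σ‖ ^ 2 := pow_le_pow_left₀ hRn hge 2
    simp only [hf]; rw [← hsq σ hσs0]; linarith
  -- the LAST crossing time
  set T : Set ℝ := {σ' | σ' ∈ Icc σ τ₀ ∧ 0 ≤ f σ'} with hT
  have hTne : T.Nonempty := ⟨σ, ⟨le_rfl, hσ⟩, hfσs⟩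
  have hTbdd : BddAbove T := ⟨τ₀, fun σ' hσ' => hσ'.1.2⟩
  have hTcl : IsClosed T := by
    have hIcc : Icc σ τ₀ ⊆ Iio 0 := fun σ' hσ' => lt_of_le_of_lt hσ'.2 hτ₀
    have h1 : IsClosed {σ' ∈ Icc σ τ₀ | 0 ≤ f σ'} :=
      (hfc.mono hIcc).preimage_isClosed_of_isClosed isClosed_Icc isClosed_Ici
    convert h1 using 1
  set σ₁ : ℝ := sSup T with hσ₁
  have hσ₁T : σ₁ ∈ T := hTcl.csSup_mem hTne hTbdd
  have hσ₁le : σ₁ ≤ τ₀ := hσ₁T.1.2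
  have hσ₁0 : σ₁ < 0 := lt_of_le_of_lt hσ₁le hτ₀
  have hσ₁lt : σ₁ < τ₀ := by
    rcases hσ₁le.lt_or_eq with h | h
    · exact h
    · exfalso; have := hσ₁T.2; rw [h] at this; linarith
  have hafter : ∀ σ', σ₁ < σ' → σ' ≤ τ₀ → f σ' < 0 := by
    intro σ' h1 h2
    by_contra hge'
    push Not at hge'
    have : σ' ≤ σ₁ := le_csSup hTbdd ⟨⟨(hσ₁T.1.1).trans h1.le, h2⟩, hge'⟩
    linarith
  have hf₁ : f σ₁ = 0 := by
    refine le_antisymm ?_ hσ₁T.2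
    by_contra hgt
    push Not at hgt
    have hca : ContinuousAt f σ₁ := hfc.continuousAt (Iio_mem_nhds hσ₁0)
    have hev : ∀ᶠ σ' in 𝓝 σ₁, 0 < f σ' := hca.eventually (lt_mem_nhds hgt)
    obtain ⟨δ, hδ, hball⟩ := Metric.eventually_nhds_iff.1 hev
    set σ' : ℝ := min (σ₁ + δ / 2) τ₀ with hσ'def
    have h1 : σ₁ < σ' := lt_min (by linarith) hσ₁lt
    have h2 : σ' ≤ τ₀ := min_le_right _ _
    have hdist : dist σ' σ₁ < δ := by
      rw [Real.dist_eq, abs_of_nonneg (by linarith)]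
      have : σ' ≤ σ₁ + δ / 2 := min_le_left _ _
      linarith
    have := hball hdist
    have := hafter σ' h1 h2
    linarith
  have hnorm₁ : ‖X σ₁‖ = R * (-σ₁) ^ n := by
    have hRn : 0 ≤ R * (-σ₁) ^ n := mul_nonneg hR.le (Real.rpow_nonneg (by linarith) _)
    have h1 : ‖X σ₁‖ ^ 2 = (R * (-σ₁) ^ n) ^ 2 := by
      rw [hsq σ₁ hσ₁0]; simp only [hf] at hf₁; linarith
    exact (pow_left_inj₀ (norm_nonneg _) hRn two_ne_zero).1 h1
  -- Fermat at the one-sided maximum of `f` on `[σ₁, τ₀]`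
  have hf' : HasDerivAt f (2 * ⟪X σ₁, u σ₁ (X σ₁)⟫ - R ^ 2 * (-(2 * n * (-σ₁) ^ (2 * n - 1)))) σ₁ :=
    (hXd σ₁ hσ₁0).norm_sq.sub (hasDerivAt_movingRadiusSq R n hσ₁0)
  have hmax : IsLocalMaxOn f (Icc σ₁ τ₀) σ₁ := by
    refine Filter.eventually_of_mem self_mem_nhdsWithin fun σ' hσ' => ?_
    rw [hf₁]
    rcases hσ'.1.lt_or_eq with h | h
    · exact (hafter σ' h hσ'.2).le
    · rw [← h, hf₁]
  have hcone : (τ₀ - σ₁) ∈ posTangentConeAt (Icc σ₁ τ₀) σ₁ := by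
    refine mem_posTangentConeAt_of_segment_subset ?_
    rw [show σ₁ + (τ₀ - σ₁) = τ₀ by ring, segment_eq_Icc hσ₁le]
  have hfermat := hmax.hasFDerivWithinAt_nonpos hf'.hasFDerivAt.hasFDerivWithinAt hcone
  have hderiv : 2 * ⟪X σ₁, u σ₁ (X σ₁)⟫ - R ^ 2 * (-(2 * n * (-σ₁) ^ (2 * n - 1))) ≤ 0 := by
    have h1 : (τ₀ - σ₁) • (2 * ⟪X σ₁, u σ₁ (X σ₁)⟫ - R ^ 2 * (-(2 * n * (-σ₁) ^ (2 * n - 1)))) ≤ 0 := by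
      simpa using hfermat
    rw [smul_eq_mul] at h1
    have h2 : 0 < τ₀ - σ₁ := by linarith
    by_contra hlt
    push Not at hlt
    have := mul_pos h2 hlt
    linarith
  -- the fast-inflow inequality at `(σ₁, X σ₁)` contradicts `hno`
  have hfast : ⟪X σ₁, u σ₁ (X σ₁)⟫ ≤ -(n * ‖X σ₁‖ ^ 2 / (-σ₁)) := by
    have hpos : 0 < -σ₁ := by linarith
    have hn2 : ‖X σ₁‖ ^ 2 = R ^ 2 * (-σ₁) ^ (2 * n) := by rw [hnorm₁, hsq σ₁ hσ₁0]
    have hkey : n * ‖X σ₁‖ ^ 2 / (-σ₁) = n * R ^ 2 * (-σ₁) ^ (2 * n - 1) := by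
      rw [hn2, Real.rpow_sub hpos, Real.rpow_one]
      field_simp
    rw [hkey]
    linarith [hderiv]
  exact absurd hfast (not_le.2 (hno σ₁ hσ₁le (X σ₁) hnorm₁))

/-- **BOUNDED SCALED SPEED TRAPS**: if `(−σ)^{1−n}‖u(σ,x)‖ ≤ b` on the moving sphere `‖x‖ = R(−σ)ⁿ` for all `σ ≤ τ₀`, with `b < nR`, then every backward
trajectory from inside the moving ball at time `τ₀` stays inside for all `σ ≤ τ₀`. [folklore] -/
theorem confined_of_boundedSpeed (hcl : IsClassicalEulerSolutionOn (Iio 0) 0 u p) (hΛc : ContinuousOn Λ (Iio 0))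
    (hΛ : ∀ s : ℝ, s < 0 → ∀ y, ‖fderiv ℝ (u s) y‖ ≤ Λ s) {R τ₀ b : ℝ} (hbR : b < n * R) (hτ₀ : τ₀ < 0)
    (hb : ∀ σ : ℝ, σ ≤ τ₀ → ∀ x : EuclideanSpace ℝ (Fin 3), ‖x‖ = R * (-σ) ^ n → (-σ) ^ (1 - n) * ‖u σ x‖ ≤ b)
    {x₀ : EuclideanSpace ℝ (Fin 3)} (hx₀ : ‖x₀‖ < R * (-τ₀) ^ n) {σ : ℝ} (hσ : σ ≤ τ₀) :
    ‖ODE.evolutionMap u τ₀ σ x₀‖ < R * (-σ) ^ n := by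
  have hpow : 0 < (-τ₀) ^ n := Real.rpow_pos_of_pos (by linarith) _
  have hR : 0 < R := by
    by_contra hle
    push Not at hle
    have : R * (-τ₀) ^ n ≤ 0 := mul_nonpos_of_nonpos_of_nonneg hle hpow.le
    linarith [norm_nonneg x₀]
  exact confined_of_noFastInflow hcl hΛc hΛ hR hτ₀
    (fun σ' hσ' x hx => SimilarityBernoulli.noFastInflow_of_boundedSpeed (lt_of_le_of_lt hσ' hτ₀) hbR (hb σ' hσ') hx) hx₀ hσ

end Summit.NavierStokesRegularity.NavierStokesRegularity.Theorems.PowerGaugeEulerLiouville.MovingSpherePiercing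

end
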